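import Mathlib
import HarnessLib
import Summits.HubbardSuperconductivity.HubbardSuperconductivity.Theorems.KLProgrammeKLRegimeCountertermJacksonRemainderReadResidueC1
import Summits.HubbardSuperconductivity.HubbardSuperconductivity.Theorems.KLProgrammeKLRegimeCountertermMeanFreeSupSlope
import Summits.HubbardSuperconductivity.HubbardSuperconductivity.Theorems.KLProgrammeKLRegimeTwoLegReadJetDefs

/-!
# Route `KLProgramme`, crux K3 — gen-8 ENGINE-FLOW child (stmt-HubbardSuperconductivity-20437 `KLRegimeEngineV17F2`), stub (C)
# `stub_twoLeg_curvature`: the (C1) door of the residue split keyed LITERALLY by the induction hypothesis `TwoLegReadJetBound … K_n n`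

Seat hubbard-kl-k3c3-p1 (g8; row «δμ-flow with klAngularMean constant piece»).  `readResidueC1_jets_of_certFrame(_klEng)` (p586216) takes the
induction hypothesis in natural-size form (`C⁴`, jets `a l`, mean-free sup `a 0`).  Here the size table is DERIVED from an abstract-table IH
`TwoLegReadJetBound L M cc cc' β U μ K_n n` (c4a-1's / k3c3-p3's natural-size induction runs with private tables `cc, cc'` and weakens to
`klC4aJetC` only at the end):
  `a l := curveJetBar cc cc' U l n` for `1 ≤ l ≤ 4`, and **`a 0 := (π/2)·curveJetBar cc cc' U 1 n`** — the mean-free sup from the SLOPE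
(`abs_sub_klAngularMean_le_half_pi_mul_of_iteratedDeriv_one`, p586654): the constant piece of `ν_n(K_n)` (its angular mean, `O(|U|)`) rides the
δμ-flow inside `K_{n+1}` and never enters the Jackson remainder, so the certificate's dominant row `a₀·N_k` is `O(U²)` like every other row
(the value entry `curveJetBar cc cc' U 0 n = (cc₀ + cc′₀|U|)·|U|·16^{−n}` is NOT used — it would put an `O(|U|)` size against an `O(U²)` bar).

* `ihSizes cc cc' U n` is NOT a definition: the table is written inline as `fun l => if l = 0 then π/2·curveJetBar cc cc' U 1 n else curveJetBar cc cc' U l n`;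
* **`readResidueC1_jets_of_twoLegReadJetBound`** (explicit thresholds `klCurveC3/klCurveU0`, abstract frame-size table `A`) and
  **`readResidueC1_jets_of_twoLegReadJetBound_klEng`** (stub (C)'s binders, `n + 1 ≤ 4`, history `FlowPieceJetsAt`, `A ≥ 10⁻¹²`):
  `J ∈ C⁴` ∧ `|J| ≤ a₁·Td + a₀·N0` ∧ `|∂ᵏJ| ≤ T.bound a k` (`1 ≤ k ≤ 3`) ∧ `|∂ᵏJ| ≤ T.boundNR a k` (`1 ≤ k ≤ 4`) with that `a`.

Assembly only; no definitions; the certificate Prop stays a hypothesis; nothing here asserts superconductivity.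
-/

noncomputable section

namespace Summit.HubbardSuperconductivity.HubbardSuperconductivity.Theorems.KLRegimeSplit

set_option linter.dupNamespace false -- summit = problem name (single-conjunct summit), D-0017

open Real
open Literature.MathematicalPhysics.QuantumLattice Literature.Probability.LatticeModels
open Summit.HubbardSuperconductivity.HubbardSuperconductivity.Theorems.PerturbedFermiCurve
open Summit.HubbardSuperconductivity.HubbardSuperconductivity.Theorems.EngineV8

section IH

variable {L M : ℕ} [NeZero L] [NeZero M]

/-- **The IH's size table for the (C1) certificate**: nonnegativity, the mean-free sup from the slope, and the jets — from
`TwoLegReadJetBound L M cc cc' β U μ K_n n` with nonnegative tables. -/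
theorem ihSizes_of_twoLegReadJetBound {cc cc' : ℕ → ℝ} (hcc : ∀ k, 0 ≤ cc k) (hcc' : ∀ k, 0 ≤ cc' k) {β U μ : ℝ} {n : ℕ}
    (hIH : TwoLegReadJetBound L M cc cc' β U μ (klFlowFrameU L M β U μ n) n) :
    (∀ l, 0 ≤ (fun l : ℕ => if l = 0 then π / 2 * curveJetBar cc cc' U 1 n else curveJetBar cc cc' U l n) l) ∧
    (∀ x, |klLocalPart L M β U μ (klFlowFrameU L M β U μ n) n x -
        klAngularMean (fun θ => klLocalPart L M β U μ (klFlowFrameU L M β U μ n) n θ)| ≤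
      (fun l : ℕ => if l = 0 then π / 2 * curveJetBar cc cc' U 1 n else curveJetBar cc cc' U l n) 0) ∧
    (∀ l, 1 ≤ l → l ≤ 4 → ∀ x, |iteratedDeriv l (fun x => klLocalPart L M β U μ (klFlowFrameU L M β U μ n) n x) x| ≤
      (fun l : ℕ => if l = 0 then π / 2 * curveJetBar cc cc' U 1 n else curveJetBar cc cc' U l n) l) := by
  have hbar : ∀ k, 0 ≤ curveJetBar cc cc' U k n := fun k => curveJetBar_nonneg hcc hcc' U k n
  refine ⟨fun l => ?_, fun x => ?_, fun l hl1 hl4 x => ?_⟩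
  · by_cases hl : l = 0
    · simp only [hl, if_true]; exact mul_nonneg (by positivity) (hbar 1)
    · simp only [hl, if_false]; exact hbar l
  · simp only [if_true]
    have hper : Function.Periodic (fun θ : ℝ => klLocalPart L M β U μ (klFlowFrameU L M β U μ n) n θ) (2 * π) :=
      klLocalPart_periodic β U μ _ n
    have hdiff : Differentiable ℝ (fun θ : ℝ => klLocalPart L M β U μ (klFlowFrameU L M β U μ n) n θ) :=
      hIH.contDiff.differentiable (by norm_num)
    exact abs_sub_klAngularMean_le_half_pi_mul_of_iteratedDeriv_one hdiff hper (fun θ => hIH.le (k := 1) (by norm_num) θ) x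
  · have hl : l ≠ 0 := by omega
    simp only [hl, if_false]
    exact hIH.le hl4 x

/-- **THE (C1) DOOR KEYED BY THE INDUCTION HYPOTHESIS** (explicit thresholds; abstract frame-size table `A`).  See the module docstring for the
size table; `J(θ) = ν_n(K_n)(θ) − (klFlowPiece n).eval (k_F^{K_{n+1}} θ)`. -/
theorem readResidueC1_jets_of_twoLegReadJetBound {R : RenConsts} (hR : ∀ j, 0 ≤ R.Gfr j) {c : ℝ} (hc : 0 < c) (hcle : c ≤ klCurveC3 R)
    {U : ℝ} (hU : 0 < U) (hUle : U ≤ klCurveU0 R) {β : ℝ} (hβmin : klBetaMin ≤ β) (hβc : β ≤ Real.exp (c / U ^ 2))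
    {μ : ℝ} (hμ : μ ∈ klWindowC) {n : ℕ} (hK : FrameOK R U (nScales β) μ (klFlowFrameU L M β U μ (n + 1)))
    {d : ℕ} (hd : klFlowDeg n = d) {A : ℕ → ℝ} {T : CutoffDefectTable} (hcert : CutoffDefectCertFrame d A T)
    (hA : ∀ j ≤ 4, ∀ p : EuclideanSpace ℝ (Fin 2),
      ‖iteratedFDeriv ℝ j (fun q : EuclideanSpace ℝ (Fin 2) => (klFlowFrameU L M β U μ (n + 1)).eval (WithLp.ofLp q)) p‖ ≤ A j)
    {cc cc' : ℕ → ℝ} (hcc : ∀ k, 0 ≤ cc k) (hcc' : ∀ k, 0 ≤ cc' k)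
    (hIH : TwoLegReadJetBound L M cc cc' β U μ (klFlowFrameU L M β U μ n) n) :
    ContDiff ℝ 4 (fun θ : ℝ => klLocalPart L M β U μ (klFlowFrameU L M β U μ n) n θ -
        (klFlowPiece L M β U μ n).eval (klFermiPoint μ (klFlowFrameU L M β U μ (n + 1)) θ)) ∧
    (∀ θ : ℝ, |klLocalPart L M β U μ (klFlowFrameU L M β U μ n) n θ -
        (klFlowPiece L M β U μ n).eval (klFermiPoint μ (klFlowFrameU L M β U μ (n + 1)) θ)| ≤
      curveJetBar cc cc' U 1 n * T.Td + π / 2 * curveJetBar cc cc' U 1 n * T.N0) ∧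
    (∀ k, 1 ≤ k → k ≤ 3 → ∀ θ : ℝ, |iteratedDeriv k (fun θ : ℝ => klLocalPart L M β U μ (klFlowFrameU L M β U μ n) n θ -
        (klFlowPiece L M β U μ n).eval (klFermiPoint μ (klFlowFrameU L M β U μ (n + 1)) θ)) θ| ≤
      T.bound (fun l : ℕ => if l = 0 then π / 2 * curveJetBar cc cc' U 1 n else curveJetBar cc cc' U l n) k) ∧
    (∀ k, 1 ≤ k → k ≤ 4 → ∀ θ : ℝ, |iteratedDeriv k (fun θ : ℝ => klLocalPart L M β U μ (klFlowFrameU L M β U μ n) n θ -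
        (klFlowPiece L M β U μ n).eval (klFermiPoint μ (klFlowFrameU L M β U μ (n + 1)) θ)) θ| ≤
      T.boundNR (fun l : ℕ => if l = 0 then π / 2 * curveJetBar cc cc' U 1 n else curveJetBar cc cc' U l n) k) := by
  obtain ⟨ha_nn, ha0, ha⟩ := ihSizes_of_twoLegReadJetBound (L := L) (M := M) hcc hcc' hIH
  obtain ⟨h1, h2, h3, h4⟩ := readResidueC1_jets_of_certFrame hR hc hcle hU hUle hβmin hβc hμ hK hd hcert hA hIH.contDiff ha_nn ha0 ha
  refine ⟨h1, fun θ => ?_, h3, h4⟩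
  have h := h2 θ
  simp only [if_true, one_ne_zero, if_false] at h
  exact h

/-- **THE (C1) DOOR KEYED BY THE INDUCTION HYPOTHESIS, AT STUB (C)'s BINDERS** (`R.WF`, `c ≤ klEngC₃6 P R`, `U ≤ klEngU₀9 P R c`, reading scale
`n + 1 ≤ 4`, history `FlowPieceJetsAt … m` for `m ≤ n`, any certificate size table `A ≥ 10⁻¹²` — the records'). -/
theorem readResidueC1_jets_of_twoLegReadJetBound_klEng {P : SplitConsts} {R : RenConsts} (hRW : R.WF) {c : ℝ} (hc : 0 < c)
    (hc6 : c ≤ klEngC₃6 P R) {μ : ℝ} (hμ : μ ∈ klWindowC) {U : ℝ} (hU : 0 < U) (hU9 : U ≤ klEngU₀9 P R c) {β : ℝ}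
    (hβmin : klBetaMin ≤ β) (hβc : β ≤ Real.exp (c / U ^ 2)) {n : ℕ} (hn : n + 1 ≤ 4)
    (hK : FrameOK R U (nScales β) μ (klFlowFrameU L M β U μ (n + 1))) (hist : ∀ m < n + 1, FlowPieceJetsAt L M β U μ R m)
    {d : ℕ} (hd : klFlowDeg n = d) {A : ℕ → ℝ} {T : CutoffDefectTable} (hcert : CutoffDefectCertFrame d A T)
    (hA12 : ∀ j ≤ 4, (1 : ℝ) / 10 ^ 12 ≤ A j)
    {cc cc' : ℕ → ℝ} (hcc : ∀ k, 0 ≤ cc k) (hcc' : ∀ k, 0 ≤ cc' k)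
    (hIH : TwoLegReadJetBound L M cc cc' β U μ (klFlowFrameU L M β U μ n) n) :
    ContDiff ℝ 4 (fun θ : ℝ => klLocalPart L M β U μ (klFlowFrameU L M β U μ n) n θ -
        (klFlowPiece L M β U μ n).eval (klFermiPoint μ (klFlowFrameU L M β U μ (n + 1)) θ)) ∧
    (∀ θ : ℝ, |klLocalPart L M β U μ (klFlowFrameU L M β U μ n) n θ -
        (klFlowPiece L M β U μ n).eval (klFermiPoint μ (klFlowFrameU L M β U μ (n + 1)) θ)| ≤
      curveJetBar cc cc' U 1 n * T.Td + π / 2 * curveJetBar cc cc' U 1 n * T.N0) ∧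
    (∀ k, 1 ≤ k → k ≤ 3 → ∀ θ : ℝ, |iteratedDeriv k (fun θ : ℝ => klLocalPart L M β U μ (klFlowFrameU L M β U μ n) n θ -
        (klFlowPiece L M β U μ n).eval (klFermiPoint μ (klFlowFrameU L M β U μ (n + 1)) θ)) θ| ≤
      T.bound (fun l : ℕ => if l = 0 then π / 2 * curveJetBar cc cc' U 1 n else curveJetBar cc cc' U l n) k) ∧
    (∀ k, 1 ≤ k → k ≤ 4 → ∀ θ : ℝ, |iteratedDeriv k (fun θ : ℝ => klLocalPart L M β U μ (klFlowFrameU L M β U μ n) n θ -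
        (klFlowPiece L M β U μ n).eval (klFermiPoint μ (klFlowFrameU L M β U μ (n + 1)) θ)) θ| ≤
      T.boundNR (fun l : ℕ => if l = 0 then π / 2 * curveJetBar cc cc' U 1 n else curveJetBar cc cc' U l n) k) := by
  have hR : ∀ j, 0 ≤ R.Gfr j := hRW.2.2
  have hcle : c ≤ klCurveC3 R := hc6.trans ((klEngC₃6_le_klEngC₃3 P R).trans (klEngC₃3_le_klCurveC3 P hR))
  have hUle : U ≤ klCurveU0 R := hU9.trans ((klEngU₀9_le_klEngU₀3 P R c).trans (klEngU₀3_le_klCurveU0 P hR c))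
  have hA := flowFrame_sizes_le_table_of_klEngU₀9 (L := L) (M := M) (β := β) (μ := μ) hRW hU hU9 hn hist hA12
  exact readResidueC1_jets_of_twoLegReadJetBound hR hc hcle hU hUle hβmin hβc hμ hK hd hcert hA hcc hcc' hIH

end IH

end Summit.HubbardSuperconductivity.HubbardSuperconductivity.Theorems.KLRegimeSplit

end
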